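import Summits.RiemannHypothesis.RiemannHypothesis.Theorems.WeilGroundStateArchimedeanWindowSimpleEvenTrial2
import Mathlib.Analysis.SpecialFunctions.ImproperIntegrals
import HarnessLib

/-!
# `ArchimedeanWindowSimpleEven` — the trial function, III: energy and pole form

`𝓔_{(log 2)/2}(h) = ∫₀^∞ ρ(t) D_t(h) dt ≤ 0.4324 + (32/45)·1.5225` (bulk `(0, 2/3]`: polynomial
majorant of degree `11` integrated exactly; tail `(2/3, ∞)`: `D_t = 32/45` and a `10`-term geometric
expansion of `ρ` with controlled remainder, `∫_{2/3}^∞ ρ ≤ 1.5225`), integrability of `ρ D_t(h)` on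
`(0, ∞)` (the form-domain hypothesis), and the pole form `P(h) ≤ 0.3973`
(`∫ h cosh(x/2) ≤ 1424/3195`). No prime enters the window (`Λ(n) = 0` on `weilPrimeIndex((log 2)/2)`).

Route `RiemannHypothesis/WeilGroundState`, item `ArchimedeanWindowSimpleEven` (stmt-RiemannHypothesis-1529).
See `WeilGroundStateArchimedeanWindowSimpleEvenGapDefs.lean` for the certificate format, the data and the
overall plan (LOWER bounds by the gap certificate `weilGapCert`, UPPER bound `ε((log 2)/2) ≤ 3/200` by the
trial function `trialFun`).
-/

namespace Summit.RiemannHypothesis.RiemannHypothesis.Theorems.WeilGroundState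

open Literature.NumberTheory.LFunctions

/-! ## The energy and the pole form of the trial function -/

section Energy

open Real Finset MeasureTheory Set Filter
open scoped BigOperators

/-- `∫_a^b Σ_k v_k x^k = Σ_k v_k (b^{k+1} − a^{k+1})/(k+1)`. [folklore] -/
theorem intervalIntegral_fin_sum_mul_pow (a b : ℝ) {n : ℕ} (v : Fin n → ℝ) :
    ∫ x in a..b, (∑ k : Fin n, v k * x ^ (k : ℕ)) =
      ∑ k : Fin n, v k * ((b ^ ((k : ℕ) + 1) - a ^ ((k : ℕ) + 1)) / ((k : ℕ) + 1)) := by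
  rw [intervalIntegral.integral_finsetSum (f := fun k x ↦ v k * x ^ (k : ℕ)) fun k _ ↦ ?_]
  · refine Finset.sum_congr rfl fun k _ ↦ ?_
    rw [intervalIntegral.integral_const_mul, integral_pow]
  · exact (continuous_const.mul (continuous_pow _)).intervalIntegrable _ _

/-- The archimedean density is measurable. [folklore] -/
theorem measurable_weilArchDensity' : Measurable weilArchDensity := by
  unfold weilArchDensity
  exact (Real.continuous_exp.comp (continuous_id.div_const 2)).measurable.div
    (continuous_const.mul Real.continuous_sinh).measurable

/-- No prime power enters the archimedean window: `Λ(n) = 0` for `n ∈ weilPrimeIndex ((log 2)/2)`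
(`log n < log 2` forces `n ≤ 1`). [folklore] -/
theorem vonMangoldt_eq_zero_of_mem_weilPrimeIndex_log_two_half {n : ℕ}
    (hn : n ∈ weilPrimeIndex (Real.log 2 / 2)) : (ArithmeticFunction.vonMangoldt n : ℝ) = 0 := by
  rw [mem_weilPrimeIndex] at hn
  rcases Nat.lt_or_ge n 2 with h2 | h2
  · interval_cases n <;> simp
  · exfalso
    have hlog : Real.log 2 ≤ Real.log n := Real.log_le_log two_pos (by exact_mod_cast h2)
    linarith

/-- The polynomial majorant `Π` of `ρ · D_t(h)` on `(0, 2/3]`, as an explicit vector of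
coefficients (degree `11`). [folklore] -/
theorem pi_expand (t : ℝ) :
    (1 - t / 2 + t ^ 2 / 8 - t ^ 3 / 48 + t ^ 4 / 384 + t ^ 5 / 3200) * (1 + t + t ^ 2 / 3) *
        (4 * t - 6 * t ^ 2 + 27 / 10 * t ^ 4) =
      ∑ k : Fin 12, (![(0 : ℝ), 4, -4, -19 / 6, 27 / 10, 291 / 160, -3877 / 14400, -1007 / 7200,
        1087 / 19200, -23 / 2000, 51 / 16000, 9 / 32000] k) * t ^ (k : ℕ) := by
  simp [Fin.sum_univ_succ]
  ring

/-- **The bulk of the energy.** `∫_{(0, 2/3]} ρ(t) D_t(h) dt ≤ 0.4324`. [folklore] -/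
theorem setIntegral_Ioc_arch_trialFun_le :
    IntegrableOn (fun t ↦ weilArchDensity t * weilIncrement trialFun t) (Ioc 0 (2 / 3)) ∧
      ∫ t in Ioc (0 : ℝ) (2 / 3), weilArchDensity t * weilIncrement trialFun t ≤ 0.4324 := by
  set Pm : ℝ → ℝ := fun t ↦ (1 - t / 2 + t ^ 2 / 8 - t ^ 3 / 48 + t ^ 4 / 384 + t ^ 5 / 3200) *
    (1 + t + t ^ 2 / 3) * (4 * t - 6 * t ^ 2 + 27 / 10 * t ^ 4) with hPm
  set f₁ : ℝ → ℝ := fun t ↦ weilArchDensity t * (8 * t ^ 2 - 12 * t ^ 3 + 27 / 5 * t ^ 5) with hf₁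
  have hs : MeasurableSet (Ioc (0 : ℝ) (2 / 3)) := measurableSet_Ioc
  -- pointwise bounds on the set
  have hbd : ∀ t ∈ Ioc (0 : ℝ) (2 / 3), 0 ≤ f₁ t ∧ f₁ t ≤ Pm t := by
    rintro t ⟨ht0, ht⟩
    have hK : 0 ≤ 4 * t - 6 * t ^ 2 + 27 / 10 * t ^ 4 := by nlinarith [sq_nonneg t, sq_nonneg (t ^ 2)]
    have hB : 0 ≤ 1 + t + t ^ 2 / 3 := by positivity
    have hρ := weilArchDensity_pos ht0
    have e1 : f₁ t = (2 * t * weilArchDensity t) * (4 * t - 6 * t ^ 2 + 27 / 10 * t ^ 4) := by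
      rw [hf₁]; ring
    refine ⟨by rw [e1]; positivity, ?_⟩
    rw [e1, hPm]
    have h1 := two_mul_mul_weilArchDensity_le ht0
    have h2 := exp_neg_half_le ht0.le (by linarith)
    have h3 : 2 * t * weilArchDensity t ≤
        (1 - t / 2 + t ^ 2 / 8 - t ^ 3 / 48 + t ^ 4 / 384 + t ^ 5 / 3200) * (1 + t + t ^ 2 / 3) :=
      h1.trans (mul_le_mul_of_nonneg_right h2 hB)
    exact mul_le_mul_of_nonneg_right h3 hK
  -- integrability
  have hPmc : Continuous Pm := by rw [hPm]; fun_prop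
  have hPmi : IntegrableOn Pm (Ioc 0 (2 / 3)) := (hPmc.integrableOn_Icc).mono_set Ioc_subset_Icc_self
  have hf₁m : AEStronglyMeasurable f₁ (volume.restrict (Ioc 0 (2 / 3))) := by
    rw [hf₁]
    exact (measurable_weilArchDensity'.mul (by fun_prop)).aestronglyMeasurable
  have hf₁i : IntegrableOn f₁ (Ioc 0 (2 / 3)) := by
    refine Integrable.mono' hPmi hf₁m ((ae_restrict_iff' hs).2 (Eventually.of_forall fun t ht ↦ ?_))
    obtain ⟨h0, h1⟩ := hbd t ht
    rw [Real.norm_of_nonneg h0]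
    exact h1
  have heq : EqOn (fun t ↦ weilArchDensity t * weilIncrement trialFun t) f₁ (Ioc 0 (2 / 3)) := by
    intro t ht
    simp only [hf₁]
    rw [weilIncrement_trialFun_of_le ht.1.le ht.2]
  have hfi : IntegrableOn (fun t ↦ weilArchDensity t * weilIncrement trialFun t) (Ioc 0 (2 / 3)) :=
    hf₁i.congr_fun heq.symm hs
  refine ⟨hfi, ?_⟩
  rw [setIntegral_congr_fun hs heq]
  calc ∫ t in Ioc (0 : ℝ) (2 / 3), f₁ t ≤ ∫ t in Ioc (0 : ℝ) (2 / 3), Pm t :=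
        setIntegral_mono_on hf₁i hPmi hs fun t ht ↦ (hbd t ht).2
    _ = ∫ t in (0 : ℝ)..(2 / 3), Pm t := (intervalIntegral.integral_of_le (by norm_num)).symm
    _ ≤ 0.4324 := by
        rw [hPm]
        simp only
        simp_rw [pi_expand]
        rw [intervalIntegral_fin_sum_mul_pow]
        simp [Fin.sum_univ_succ]
        norm_num

/-- `e^{-2t} ≤ (3583/5000)⁴` for `t ≥ 2/3`. [folklore] -/
theorem exp_neg_two_mul_le {t : ℝ} (ht : 2 / 3 ≤ t) : Real.exp (-(2 * t)) ≤ (3583 / 5000 : ℝ) ^ 4 := by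
  have h1 : Real.exp (-(2 * t)) ≤ Real.exp (-(4 / 3)) := Real.exp_le_exp.2 (by linarith)
  have h2 : Real.exp (-(4 / 3) : ℝ) = Real.exp (-(1 / 3)) ^ 4 := by
    rw [← Real.exp_nat_mul]; norm_num
  have h3 : Real.exp (-(1 / 3) : ℝ) ^ 4 ≤ (3583 / 5000 : ℝ) ^ 4 :=
    pow_le_pow_left₀ (Real.exp_pos _).le exp_neg_third_le 4
  linarith [h2.le, h2.ge]

/-- `e^{-(2k+1/2)(2/3)} ≤ u^{4k+1}`, `u = 3583/5000`. [folklore] -/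
theorem exp_node_le (k : ℕ) :
    Real.exp (-(2 * (k : ℝ) + 1 / 2) * (2 / 3)) ≤ (3583 / 5000 : ℝ) ^ (4 * k + 1) := by
  have h1 : Real.exp (-(2 * (k : ℝ) + 1 / 2) * (2 / 3)) = Real.exp (-(1 / 3)) ^ (4 * k + 1) := by
    rw [← Real.exp_nat_mul]; congr 1; push_cast; ring
  rw [h1]
  exact pow_le_pow_left₀ (Real.exp_pos _).le exp_neg_third_le _

/-- The archimedean density as a finite geometric sum plus a controlled tail: for `t ≥ 2/3`,
`ρ(t) ≤ Σ_{k<10} e^{-(2k+1/2)t} + e^{-(41/2)t}/(1 − u⁴)`, `u = 3583/5000 ≥ e^{-1/3}`. [folklore] -/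
theorem weilArchDensity_le_geom {t : ℝ} (ht : 2 / 3 ≤ t) :
    weilArchDensity t ≤
      ∑ k ∈ Finset.range 10, Real.exp (-(2 * (k : ℝ) + 1 / 2) * t) +
        Real.exp (-(41 / 2) * t) / (1 - (3583 / 5000 : ℝ) ^ 4) := by
  set q : ℝ := Real.exp (-(2 * t)) with hq
  set Q : ℝ := (3583 / 5000 : ℝ) ^ 4 with hQ
  have hq0 : 0 < q := Real.exp_pos _
  have hqQ : q ≤ Q := exp_neg_two_mul_le ht
  have hQ1 : Q < 1 := by rw [hQ]; norm_num
  have h1q : 0 < 1 - q := by linarith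
  have h1Q : 0 < 1 - Q := by linarith
  rw [weilArchDensity_eq t, ← hq]
  -- 1/(1 − q) = Σ_{k<10} q^k + q^10/(1 − q)
  have hgeom : 1 / (1 - q) = ∑ k ∈ Finset.range 10, q ^ k + q ^ 10 / (1 - q) := by
    have h := geom_sum_mul_neg q 10
    field_simp
    linarith
  have he0 : 0 < Real.exp (-(t / 2)) := Real.exp_pos _
  rw [div_eq_mul_one_div, hgeom, mul_add, Finset.mul_sum]
  refine add_le_add (le_of_eq (Finset.sum_congr rfl fun k _ ↦ ?_)) ?_
  · rw [hq, ← Real.exp_nat_mul, ← Real.exp_add]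
    congr 1; ring
  · have h2 : Real.exp (-(t / 2)) * (q ^ 10 / (1 - q)) ≤ Real.exp (-(t / 2)) * (q ^ 10 / (1 - Q)) := by
      refine mul_le_mul_of_nonneg_left ?_ he0.le
      exact div_le_div_of_nonneg_left (by positivity) h1Q (by linarith)
    refine h2.trans (le_of_eq ?_)
    rw [hq, ← Real.exp_nat_mul, mul_div_assoc', ← Real.exp_add]
    congr 2; push_cast; ring

/-- **The tail of the energy.** `ρ` is integrable on `(2/3, ∞)` and `∫_{2/3}^∞ ρ ≤ 1.5225`
(`= artanh(e^{-1/3}) + arctan(e^{-1/3}) = 1.52221…`). [folklore] -/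
theorem setIntegral_Ioi_weilArchDensity_le :
    IntegrableOn weilArchDensity (Ioi (2 / 3)) ∧ ∫ t in Ioi (2 / 3 : ℝ), weilArchDensity t ≤ 1.5225 := by
  set u : ℝ := 3583 / 5000 with hu
  set G : ℝ → ℝ := fun t ↦ ∑ k ∈ Finset.range 10, Real.exp (-(2 * (k : ℝ) + 1 / 2) * t) +
    Real.exp (-(41 / 2) * t) / (1 - u ^ 4) with hG
  have hs : MeasurableSet (Ioi (2 / 3 : ℝ)) := measurableSet_Ioi
  have hak : ∀ k : ℕ, -(2 * (k : ℝ) + 1 / 2) < 0 := fun k ↦ by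
    have : (0 : ℝ) ≤ k := Nat.cast_nonneg k
    linarith
  have hik : ∀ k : ℕ, IntegrableOn (fun t ↦ Real.exp (-(2 * (k : ℝ) + 1 / 2) * t)) (Ioi (2 / 3)) :=
    fun k ↦ integrableOn_exp_mul_Ioi (hak k) _
  have hi41 : IntegrableOn (fun t ↦ Real.exp (-(41 / 2) * t) / (1 - u ^ 4)) (Ioi (2 / 3)) :=
    (integrableOn_exp_mul_Ioi (by norm_num) _).div_const _
  have hGi : IntegrableOn G (Ioi (2 / 3)) := by
    rw [hG]
    exact (integrable_finsetSum _ fun k _ ↦ hik k).add hi41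
  have hbd : ∀ t ∈ Ioi (2 / 3 : ℝ), 0 ≤ weilArchDensity t ∧ weilArchDensity t ≤ G t := by
    intro t ht
    have ht' : 2 / 3 < t := ht
    exact ⟨(weilArchDensity_pos (by linarith)).le, weilArchDensity_le_geom ht'.le⟩
  have hρi : IntegrableOn weilArchDensity (Ioi (2 / 3)) := by
    refine Integrable.mono' hGi measurable_weilArchDensity'.aestronglyMeasurable
      ((ae_restrict_iff' hs).2 (Eventually.of_forall fun t ht ↦ ?_))
    obtain ⟨h0, h1⟩ := hbd t ht
    rw [Real.norm_of_nonneg h0]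
    exact h1
  refine ⟨hρi, ?_⟩
  have hint : ∫ t in Ioi (2 / 3 : ℝ), G t =
      ∑ k ∈ Finset.range 10, Real.exp (-(2 * (k : ℝ) + 1 / 2) * (2 / 3)) / (2 * (k : ℝ) + 1 / 2) +
        Real.exp (-(41 / 2) * (2 / 3 : ℝ)) / (41 / 2) / (1 - u ^ 4) := by
    rw [hG]
    simp only
    rw [integral_add (integrable_finsetSum _ fun k _ ↦ hik k) hi41,
      integral_finsetSum _ fun k _ ↦ hik k]
    congr 1
    · refine Finset.sum_congr rfl fun k _ ↦ ?_
      rw [integral_exp_mul_Ioi (hak k)]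
      have : (2 * (k : ℝ) + 1 / 2) ≠ 0 := by linarith [hak k]
      field_simp
    · rw [integral_div, integral_exp_mul_Ioi (by norm_num)]
      congr 1
      field_simp
  calc ∫ t in Ioi (2 / 3 : ℝ), weilArchDensity t ≤ ∫ t in Ioi (2 / 3 : ℝ), G t :=
        setIntegral_mono_on hρi hGi hs fun t ht ↦ (hbd t ht).2
    _ = _ := hint
    _ ≤ ∑ k ∈ Finset.range 10, u ^ (4 * k + 1) / (2 * (k : ℝ) + 1 / 2) +
          u ^ 41 / (41 / 2) / (1 - u ^ 4) := by
        refine add_le_add (Finset.sum_le_sum fun k _ ↦ ?_) ?_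
        · exact div_le_div_of_nonneg_right (exp_node_le k) (by linarith [hak k])
        · refine div_le_div_of_nonneg_right (div_le_div_of_nonneg_right ?_ (by norm_num))
            (by rw [hu]; norm_num)
          calc Real.exp (-(41 / 2) * (2 / 3 : ℝ)) = Real.exp (-(2 * ((10 : ℕ) : ℝ) + 1 / 2) * (2 / 3)) := by
                norm_num
            _ ≤ (3583 / 5000 : ℝ) ^ (4 * 10 + 1) := exp_node_le 10
            _ = u ^ 41 := by rw [hu]
    _ ≤ 1.5225 := by
        rw [hu]
        simp only [Finset.sum_range_succ, Finset.sum_range_zero]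
        norm_num

/-- **The energy of the trial function.** `t ↦ ρ(t) D_t(h)` is integrable on `(0, ∞)` and
`𝓔_{(log 2)/2}(h) ≤ 0.4324 + (32/45) · 1.5225`. [folklore] -/
theorem weilDirichletEnergy_trialFun_le :
    IntegrableOn (fun t ↦ weilArchDensity t * weilIncrement trialFun t) (Ioi 0) ∧
      weilDirichletEnergy (Real.log 2 / 2) trialFun ≤ 0.4324 + 32 / 45 * 1.5225 := by
  obtain ⟨hi1, hb1⟩ := setIntegral_Ioc_arch_trialFun_le
  obtain ⟨hi2, hb2⟩ := setIntegral_Ioi_weilArchDensity_le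
  have heq : EqOn (fun t ↦ weilArchDensity t * weilIncrement trialFun t)
      (fun t ↦ 32 / 45 * weilArchDensity t) (Ioi (2 / 3)) := by
    intro t ht
    have ht' : 2 / 3 < t := ht
    simp only
    rw [weilIncrement_trialFun_of_ge ht'.le]
    ring
  have hi2c : IntegrableOn (fun t ↦ 32 / 45 * weilArchDensity t) (Set.Ioi (2 / 3)) := hi2.const_mul _
  have hi2' : IntegrableOn (fun t ↦ weilArchDensity t * weilIncrement trialFun t) (Set.Ioi (2 / 3)) :=
    hi2c.congr_fun heq.symm measurableSet_Ioi
  have hunion : Set.Ioc (0 : ℝ) (2 / 3) ∪ Set.Ioi (2 / 3) = Set.Ioi 0 := Set.Ioc_union_Ioi_eq_Ioi (by norm_num)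
  have hi : IntegrableOn (fun t ↦ weilArchDensity t * weilIncrement trialFun t) (Ioi 0) := by
    rw [← hunion]; exact hi1.union hi2'
  refine ⟨hi, ?_⟩
  unfold weilDirichletEnergy
  rw [Finset.sum_eq_zero fun n hn ↦ by
    rw [vonMangoldt_eq_zero_of_mem_weilPrimeIndex_log_two_half hn]; simp, zero_add, ← hunion,
    setIntegral_union (Set.disjoint_left.2 fun t h1 h2 ↦ ?_) measurableSet_Ioi hi1 hi2',
    setIntegral_congr_fun measurableSet_Ioi heq, integral_const_mul]
  · linarith [mul_le_mul_of_nonneg_left hb2 (by norm_num : (0 : ℝ) ≤ 32 / 45)]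
  · exact (not_lt.2 h1.2) h2

/-! ## The pole form of the trial function -/

/-- `∫ h(x) cosh(x/2) dx ≤ 1424/3195` and it is non-negative. [folklore] -/
theorem integral_trialFun_mul_cosh_le :
    0 ≤ ∫ x, max (1 - 9 * x ^ 2) 0 * Real.cosh (x / 2) ∧
      ∫ x, max (1 - 9 * x ^ 2) 0 * Real.cosh (x / 2) ≤ 1424 / 3195 := by
  refine ⟨integral_nonneg fun x ↦ mul_nonneg (le_max_right _ _) (Real.cosh_pos _).le, ?_⟩
  have h1 : ∫ x, max (1 - 9 * x ^ 2) 0 * Real.cosh (x / 2) =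
      ∫ x in (-(1 / 3 : ℝ))..(1 / 3), max (1 - 9 * x ^ 2) 0 * Real.cosh (x / 2) := by
    symm
    apply intervalIntegral.integral_eq_integral_of_support_subset
    intro x hx
    rw [Function.mem_support] at hx
    have h9 : 9 * x ^ 2 < 1 := by
      by_contra h
      exact hx (by rw [max_eq_right (by linarith), zero_mul])
    have := sq_lt_one_iff.1 h9
    exact ⟨this.1, this.2.le⟩
  rw [h1]
  calc ∫ x in (-(1 / 3 : ℝ))..(1 / 3), max (1 - 9 * x ^ 2) 0 * Real.cosh (x / 2)
      ≤ ∫ x in (-(1 / 3 : ℝ))..(1 / 3), ((1 : ℝ) + 0 * x + (-(9 : ℝ) + 9 / 71) * x ^ 2 + 0 * x ^ 3 +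
          (-(81 / 71 : ℝ)) * x ^ 4) := by
        refine intervalIntegral.integral_mono_on (by norm_num)
          ((Continuous.intervalIntegrable (by fun_prop) _ _))
          ((Continuous.intervalIntegrable (by fun_prop) _ _)) fun x hx ↦ ?_
        have hx' : 9 * x ^ 2 ≤ 1 := by nlinarith [hx.1, hx.2]
        rw [max_eq_left (by linarith)]
        have hc := cosh_half_le hx'
        have h0 : 0 ≤ 1 - 9 * x ^ 2 := by linarith
        calc (1 - 9 * x ^ 2) * Real.cosh (x / 2) ≤ (1 - 9 * x ^ 2) * (1 + 9 / 71 * x ^ 2) :=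
              mul_le_mul_of_nonneg_left hc h0
          _ = _ := by ring
    _ = 1424 / 3195 := by rw [integral_poly4]; norm_num

/-- **The pole form of the trial function**: `P(h) ≤ 2 (1424/3195)² ≤ 0.3973`. [folklore] -/
theorem weilPoleForm_trialFun_le : weilPoleForm trialFun ≤ 0.3973 := by
  obtain ⟨h0, h1⟩ := integral_trialFun_mul_cosh_le
  unfold weilPoleForm
  have hc : ∫ t, trialFun t * (Real.cosh (t / 2) : ℂ) =
      ((∫ x, max (1 - 9 * x ^ 2) 0 * Real.cosh (x / 2) : ℝ) : ℂ) := by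
    rw [← integral_complex_ofReal]
    congr 1 with t
    rw [trialFun_apply]
    push_cast
    ring
  rw [hc, Complex.norm_real, Real.norm_of_nonneg h0]
  have h2 : 0 ≤ ‖∫ t, trialFun t * (Real.sinh (t / 2) : ℂ)‖ ^ 2 := sq_nonneg _
  nlinarith [h1, h0]

end Energy

end Summit.RiemannHypothesis.RiemannHypothesis.Theorems.WeilGroundState
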